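import Mathlib
import Summits.Ventures.PercRepro2.SwOutCrossBaseMark
import Summits.Ventures.PercRepro2.SwOutCrossBaseBlueEdges

/-!
# THE BLOCK THEOREM OF A JUNCTION WITH A CONNECTED DROPPED COMPONENT (blind cell PercRepro2,
night-4 g23, 2026-08-28; proofs/NIGHT4-G23.md §10, step (4))

**Theorem** `CrossBase.rigid_block_cross`: for a cross base (u-arms `U j` joined to `u`, the
dropped vertices `p i` joined to `u` and among themselves along the connected cross-edge graph `G`,
with their outside edges, far arms `F k`, the base colouring `σ`) with `l`, `o` outside the
structure and every edge class non-empty, the BLOCK `C = crossReal '' {¬ Leak}` satisfies the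
rigid counting inequality of (SW) on `C ∩ tgtU` (the root `l` outside the structure, the mark `o`
anywhere but at `u` or a dropped vertex) for every up-set `𝓔` of edge sets:
`#{ζ ∈ C ∩ Q : redEdges ζ h ∈ 𝓔} ≤ #{ζ ∈ C ∩ Q : blueEdges ζ h ∈ 𝓔}`.
Proof: the abstract theorem `card_le_crossGenFar` for the edge-atom fibre data `fibKEE` with
`𝒯` := the up-closure of the types of the non-leaking points whose realisation lies in the
conditioning — the TYPE LEMMA `mem_tgtU_of_betterFG_mark` makes `QFG 𝒯` exactly the pulled-back
conditioning — and `𝓔` pulled back along the monotone edge map `φX`; the edge-set forms of the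
hull formulas (`redEdges_crossReal` / `blueEdges_crossReal`) identify the two counts with the
abstract ones, and `crossReal_injective` transports the cardinalities.
-/

namespace Summit.Ventures.PercRepro2

namespace CrossArm

open Hull LocRows

variable {V E : Type*}

open scoped Classical

section Order

variable {ι X κ : Type*} {G : SimpleGraph X} [Fintype X] [DecidableEq X] [DecidableRel G.Adj]
  [Nonempty X] (hG : G.Connected)

/-- The order of `card_le_crossGenFar` on the edge-atom fibre data is reflexive. -/
lemma betterFG_refl (x : PtXG ι κ X G) :
    BetterFG (fibKEE G hG) (typFG (fibKEE G hG) (toGen G x)) (typFG (fibKEE G hG) (toGen G x)) :=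
  (betterFG_iff hG).2 ⟨fun _ h => h, fun _ h => h, fun _ h => h, fun _ _ h => h, fun _ _ h => h⟩

omit [Fintype X] [DecidableEq X] [Nonempty X] in
/-- The restricted partition order on labels is transitive. -/
lemma betterKE_trans {l₁ l₂ l₃ : LabelKE X} (h₁ : BetterKE l₂ l₁) (h₂ : BetterKE l₃ l₂) :
    BetterKE l₃ l₁ :=
  ⟨fun i hi => h₂.1 i (h₁.1 i hi), fun i j hij => h₂.2.1 i j (h₁.2.1 i j hij),
    fun i j hij => h₁.2.2 i j (h₂.2.2 i j hij)⟩

/-- The order of `card_le_crossGenFar` on the edge-atom fibre data is transitive. -/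
lemma betterFG_trans {t₁ t₂ t₃ : TypFG (LabelKE X) ι κ} (h₁ : BetterFG (fibKEE G hG) t₂ t₁)
    (h₂ : BetterFG (fibKEE G hG) t₃ t₂) : BetterFG (fibKEE G hG) t₃ t₁ :=
  ⟨fun k hk => h₂.1 k (h₁.1 k hk), fun j hj => h₂.2.1 j (h₁.2.1 j hj),
    betterKE_trans h₁.2.2 h₂.2.2⟩

end Order

section Block

variable {ι X κ : Type*} [Fintype ι] [DecidableEq ι] [Nonempty ι] [Fintype κ] [DecidableEq κ]
  [Fintype X] [DecidableEq X] [Nonempty X] {G : SimpleGraph X} [DecidableRel G.Adj]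
  [Fintype E] [DecidableEq E]

/-- The block of a cross base: the realisations of the non-leaking points. -/
noncomputable def blockCX (ends : E → Sym2 V) (σ : Config E) (u : V) (U : ι → Set V)
    (p : X → V) (G : SimpleGraph X) [DecidableRel G.Adj] (F : κ → Set V) : Finset (Config E) :=
  (Finset.univ.filter fun q : PtXG ι κ X G => ¬ LeakRX G q ∧ ¬ LeakBX G q).image
    (crossReal ends u U p G F σ)

variable {ends : E → Sym2 V} {σ : Config E} {h u : V} {U : ι → Set V} {p : X → V}
  {F : κ → Set V} (hG : G.Connected) (hb : CrossBase ends σ h u U p G F)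
include hG hb

/-- **THE BLOCK THEOREM OF A JUNCTION WITH A CONNECTED DROPPED COMPONENT**: the rigid counting
inequality on the block of a cross base, for every up-set of edge sets, with the root `l` outside
the structure and the mark `o` anywhere but at `u` or a dropped vertex. -/
theorem CrossBase.rigid_block_cross (hup : ∀ i, ∃ e, ends e = s(u, p i))
    (hcross : ∀ i j, G.Adj i j → ∃ e, ends e = s(p i, p j))
    (hcrossE : ∀ s : G.edgeSet, ∃ e, e ∈ clsCX ends p G s)
    (hFe : ∀ k, ∃ e, e ∈ touches ends (F k)) (hext : ∀ i, ∃ e, e ∈ clsExtX ends u p i)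
    {l o : V} (hl : l ∉ strX h u U p F) (hou : o ≠ u) (hop : ∀ i, o ≠ p i)
    {𝓔 : Set (Set E)} (h𝓔 : IsUpperSet 𝓔) :
    ((blockCX ends σ u U p G F).filter fun ζ =>
        ζ ∈ (tgtU ends l h {S : Set V | o ∈ S} : Set (Config E)) ∧ redEdges ends ζ h ∈ 𝓔).card ≤
      ((blockCX ends σ u U p G F).filter fun ζ =>
        ζ ∈ (tgtU ends l h {S : Set V | o ∈ S} : Set (Config E)) ∧
          blueEdges ends ζ h ∈ 𝓔).card := by
  have hinj := hb.crossReal_injective hFe hup hcrossE hext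
  -- the up-closure of the types of the conditioning
  let 𝒯 : Set (TypFG (LabelKE X) ι κ) := {t | ∃ q : PtXG ι κ X G, ¬ LeakRX G q ∧ ¬ LeakBX G q ∧
    crossReal ends u U p G F σ q ∈ (tgtU ends l h {S : Set V | o ∈ S} : Set (Config E)) ∧
    BetterFG (fibKEE G hG) t (typFG (fibKEE G hG) (toGen G q))}
  have h𝒯 : IsUpFG (fibKEE G hG) 𝒯 := by
    rintro t ⟨q, hqR, hqB, hq, hle⟩ t' hle'
    exact ⟨q, hqR, hqB, hq, betterFG_trans hG hle hle'⟩
  -- the pulled-back conditioning is `QFG 𝒯` (the type lemma)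
  have hQ : QFG (fibKEE G hG) 𝒯 = Finset.univ.filter fun q : PtXG ι κ X G =>
      ¬ LeakRX G q ∧ ¬ LeakBX G q ∧
        crossReal ends u U p G F σ q ∈ (tgtU ends l h {S : Set V | o ∈ S} : Set (Config E)) := by
    ext q
    simp only [QFG, Finset.mem_filter, Finset.mem_univ, true_and]
    have hleak : ¬ LeakG (fibKEE G hG) q.2 ↔ ¬ (LeakRX G q ∨ LeakBX G q) :=
      (leakG_toGen_iff hG q).not
    rw [hleak, not_or]
    constructor
    · rintro ⟨⟨hqR, hqB⟩, q₀, hq₀R, hq₀B, hq₀, hle⟩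
      exact ⟨hqR, hqB, hb.mem_tgtU_of_betterFG_mark hG hup hcross hq₀R hqR hqB hle hl hou hop hq₀⟩
    · rintro ⟨hqR, hqB, hq⟩
      exact ⟨⟨hqR, hqB⟩, q, hqR, hqB, hq, betterFG_refl hG q⟩
  have h𝓔' : IsUpperSet (φX ends σ h u U p G F ⁻¹' 𝓔) :=
    h𝓔.preimage (φX_mono ends σ h u U p G F)
  have key := card_le_crossGenFar (F := fibKEE G hG) h𝒯 h𝓔'
  have e1 : ((blockCX ends σ u U p G F).filter fun ζ =>
      ζ ∈ (tgtU ends l h {S : Set V | o ∈ S} : Set (Config E)) ∧ redEdges ends ζ h ∈ 𝓔) =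
      ((QFG (fibKEE G hG) 𝒯).filter fun q => ERFG (fibKEE G hG) q ∈
        φX ends σ h u U p G F ⁻¹' 𝓔).image (crossReal ends u U p G F σ) := by
    ext ζ
    simp only [blockCX, hQ, Finset.mem_filter, Finset.mem_image, Finset.mem_univ, true_and,
      Set.mem_preimage]
    constructor
    · rintro ⟨⟨q, ⟨hqR, hqB⟩, rfl⟩, hq, hE⟩
      refine ⟨q, ⟨⟨hqR, hqB, hq⟩, ?_⟩, rfl⟩
      rw [hb.redEdges_crossReal hG hup hcross hqR] at hE
      exact hE
    · rintro ⟨q, ⟨⟨hqR, hqB, hq⟩, hE⟩, rfl⟩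
      refine ⟨⟨q, ⟨hqR, hqB⟩, rfl⟩, hq, ?_⟩
      rw [hb.redEdges_crossReal hG hup hcross hqR]
      exact hE
  have e2 : ((blockCX ends σ u U p G F).filter fun ζ =>
      ζ ∈ (tgtU ends l h {S : Set V | o ∈ S} : Set (Config E)) ∧ blueEdges ends ζ h ∈ 𝓔) =
      ((QFG (fibKEE G hG) 𝒯).filter fun q => EBFG (fibKEE G hG) q ∈
        φX ends σ h u U p G F ⁻¹' 𝓔).image (crossReal ends u U p G F σ) := by
    ext ζ
    simp only [blockCX, hQ, Finset.mem_filter, Finset.mem_image, Finset.mem_univ, true_and,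
      Set.mem_preimage]
    constructor
    · rintro ⟨⟨q, ⟨hqR, hqB⟩, rfl⟩, hq, hE⟩
      refine ⟨q, ⟨⟨hqR, hqB, hq⟩, ?_⟩, rfl⟩
      rw [hb.blueEdges_crossReal hG hup hcross hqB] at hE
      exact hE
    · rintro ⟨q, ⟨⟨hqR, hqB, hq⟩, hE⟩, rfl⟩
      refine ⟨⟨q, ⟨hqR, hqB⟩, rfl⟩, hq, ?_⟩
      rw [hb.blueEdges_crossReal hG hup hcross hqB]
      exact hE
  rw [e1, e2, Finset.card_image_of_injective _ hinj, Finset.card_image_of_injective _ hinj]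
  exact key

end Block

end CrossArm

end Summit.Ventures.PercRepro2
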